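import Mathlib
import Summits.NavierStokesRegularity.NavierStokesRegularity.Theorems.WakeRatchetTailRatchetScalarFrontAmplitude
import Summits.NavierStokesRegularity.NavierStokesRegularity.Theorems.WakeRatchetTailRatchetScalarFrontFloor
import HarnessLib

/-!
# Scalar dyadic fronts (construction `DyadicScalarFronts`, stmt-NavierStokesRegularity-21808):
# NO SLOW FRONTS — the hop ratio is bounded away from `1` by the spread and the type-I constant,
# `s − 1 ≥ 1 / ((6Λ + 2Λ⁻¹)·(m + Λm² + m²/Λ))`

Support file for the crux `WakeRatchet.TailRatchet` (stmt-21808; refuted BY NAME modulo the construction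
`WakeRatchetDyadicFront.DyadicScalarFronts`, p589335; MODEL lattice ODEs of Tao 2016 §1.2, §4 — nothing here
concerns the Navier–Stokes equations, and no item is closed).  Census item G2 of the continuation programme
R-glob («`s ≥ 1 + c(δ)` along fronts») in the form available a priori: modulo the renormalised sup norm.

With `g(t) = |t|·a(t)` and the autonomous amplitude law of `…ScalarFrontAmplitude`,
`|t|·g' = −g + Λ g(·/s)² − Λ⁻¹ g·g(s·)`, whose local part is LOGISTIC with unstable equilibrium
`F⋆ = 1/(Λ − Λ⁻¹)`: read the profile towards the past.  It exceeds `F⋆/2` somewhere (amplitude floor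
`WakeRatchetScalarFrontFloor.scalarFront_one_le`: `sup g ≥ F⋆`) and is below `F⋆/2` further out
(`exists_amp_lt`, integrability), so there is a LAST point `t₂` of a window `[t_b, t_a]` with `g(t₂) = F⋆/2` and
`g > F⋆/2` on `(t₂, t_a)`; there `g'(t₂) ≥ 0`, while the law with both neighbours within `K(s−1)` of `F⋆/2`
(rung bounds, `K = m + Λm² + m²/Λ` for a type-I bound `m`) gives
`0 ≤ |t₂|g'(t₂) ≤ −F⋆/4 + K(s−1)·(F⋆/2)(2Λ+Λ⁻¹) + ΛK²(s−1)²`.  Hence (`no_slow_front`)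

  `(m + Λm² + m²/Λ)·(s − 1) ≥ 1/(6Λ + 2Λ⁻¹)`

for EVERY non-trivial profile with the clauses of `DyadicScalarFronts` and every type-I bound `m`
(`hop_gap_pos`: with the front's own constant from `…ScalarFrontAdmissible.scale_bound`).  A family of fronts
whose renormalised amplitude stays bounded cannot approach hop ratio `1`: the `s → 1⁺` limit of the equation is
the local logistic law, which has no pulse.  Equivalently a lower bound on the DELAY `T = log s` of the
dictionary DSS wave in terms of its profile norm.

HONEST FRAMING: elementary real analysis about a MODEL lattice ODE; existence of fronts is NOT proved; an a-priori
sup bound `m = m(Λ)` along the branch (census G1/G3) is NOT proved here; nothing about Navier–Stokes.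
-/

noncomputable section

set_option linter.dupNamespace false

namespace Summit.NavierStokesRegularity.NavierStokesRegularity.Theorems

namespace WakeRatchetScalarFrontNoSlow

open Filter Topology Set MeasureTheory intervalIntegral
open Literature.Analysis.FluidPDE Literature.Analysis.FluidPDE.TaoCascade
open WakeRatchetScalarFrontWake WakeRatchetScalarFrontPositive WakeRatchetScalarFrontFloor
open WakeRatchetScalarFrontAmplitude

variable {ε₀ s : ℝ} {a : ℝ → ℝ}

/-! ## No slow fronts -/

/-- `Λ = (1+ε₀)^{5/2} > 1` for `ε₀ > 0`. [cite: Tao2016AveragedNS, §4 (4.1)] -/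
theorem one_lt_bigLam' (hε : 0 < ε₀) : 1 < bigLam ε₀ := by
  unfold bigLam
  exact Real.one_lt_rpow (by linarith) (by norm_num)

/-- **NO SLOW FRONTS (census G2 modulo the sup norm).**  For every non-trivial profile `a` with the clauses of
`DyadicScalarFronts` (front equation on `t < 0` at base `Λ = bigLam ε₀`, hop ratio `s > 1`, integrable on
`(−∞,0)`, bounded near `0⁻`) and every type-I bound `|t|·|a(t)| ≤ m` (`t < 0`):

  `1/(6Λ + 2Λ⁻¹) ≤ (m + Λm² + m²/Λ)·(s − 1)`.

The hop ratio of a scalar dyadic DSS front is bounded away from `1` in terms of the spread and the renormalised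
amplitude only. [cite: Tao2016AveragedNS, §1.2 (dyadic model), §4; elementary] -/
theorem no_slow_front (hε : 0 < ε₀) (hs : 1 < s)
    (hode : ∀ t : ℝ, t < 0 → HasDerivAt a
      (bigLam ε₀ / s ^ 2 * a (t / s) ^ 2 - s / bigLam ε₀ * a t * a (s * t)) t)
    (hint : IntegrableOn a (Iio 0))
    (hbdd : ∃ t₀ : ℝ, t₀ < 0 ∧ ∃ P : ℝ, ∀ t : ℝ, t₀ ≤ t → t < 0 → |a t| ≤ P)
    (hne : ∃ t : ℝ, t < 0 ∧ a t ≠ 0) {m : ℝ} (hM : ∀ t : ℝ, t < 0 → |t| * |a t| ≤ m) :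
    1 / (6 * bigLam ε₀ + 2 / bigLam ε₀) ≤ (m + bigLam ε₀ * m ^ 2 + m ^ 2 / bigLam ε₀) * (s - 1) := by
  have hs0 : 0 < s := by linarith
  have hΛ1 : 1 < bigLam ε₀ := one_lt_bigLam' hε
  have hΛ : 0 < bigLam ε₀ := by linarith
  have hΛi : 0 < (bigLam ε₀)⁻¹ := inv_pos.2 hΛ
  -- the logistic threshold `F⋆ = 1/(Λ − Λ⁻¹)` and the level `θ = F⋆/2`
  have hc : 0 < bigLam ε₀ - (bigLam ε₀)⁻¹ := by
    have : (bigLam ε₀)⁻¹ < 1 := inv_lt_one_of_one_lt₀ hΛ1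
    linarith
  set θ : ℝ := 1 / (2 * (bigLam ε₀ - (bigLam ε₀)⁻¹)) with hθ
  have hθ0 : 0 < θ := by positivity
  have hθc : (bigLam ε₀ - (bigLam ε₀)⁻¹) * θ = 1 / 2 := by
    rw [hθ, one_div, one_div, mul_inv, ← mul_assoc, mul_comm (bigLam ε₀ - (bigLam ε₀)⁻¹),
      mul_assoc, mul_inv_cancel₀ hc.ne', mul_one]
  have hpos := pos_of_front hε hs hode hint hbdd hne
  have hcont := continuousOn_of_ode hode
  have hg' : ∀ t : ℝ, t < 0 → HasDerivAt (fun u => -u * a u)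
      (-a t - t * (bigLam ε₀ / s ^ 2 * a (t / s) ^ 2 - s / bigLam ε₀ * a t * a (s * t))) t :=
    fun t ht => hasDerivAt_amp hode ht
  -- Step A: the amplitude exceeds `θ` somewhere (amplitude floor)
  have hA : ∃ ta : ℝ, ta < 0 ∧ θ < -ta * a ta := by
    by_contra hcon
    push Not at hcon
    have hM' : ∀ t : ℝ, t < 0 → |t| * |a t| ≤ θ := by
      intro t ht
      rw [abs_of_neg ht, abs_of_pos (hpos t ht)]
      exact hcon t ht
    have h1 := scalarFront_one_le hε hs hode hint hbdd hne hM'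
    rw [hθc] at h1
    norm_num at h1
  obtain ⟨ta, hta, hgta⟩ := hA
  -- Step B: further in the past it is below `θ`
  obtain ⟨tb, htb, hgtb⟩ := exists_amp_lt hint hpos hθ0 hta
  -- Step C: the last point of `[tb, ta]` at level `≤ θ`
  set S : Set ℝ := Icc tb ta ∩ (fun u => -u * a u) ⁻¹' (Iic θ) with hS
  have hSne : S.Nonempty := ⟨tb, ⟨left_mem_Icc.2 htb.le, le_of_lt hgtb⟩⟩
  have hSbdd : BddAbove S := ⟨ta, fun u hu => hu.1.2⟩
  have hgc : ContinuousOn (fun u : ℝ => -u * a u) (Icc tb ta) :=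
    (continuous_neg.continuousOn).mul (hcont.mono fun u hu => lt_of_le_of_lt hu.2 hta)
  have hSclosed : IsClosed S := hgc.preimage_isClosed_of_isClosed isClosed_Icc isClosed_Iic
  obtain ⟨⟨htb₂, ht₂le⟩, hgt₂le⟩ : sSup S ∈ S := hSclosed.csSup_mem hSne hSbdd
  set t₂ : ℝ := sSup S with ht₂
  have hgt₂le : -t₂ * a t₂ ≤ θ := hgt₂le
  have ht₂lt : t₂ < ta := by
    rcases ht₂le.lt_or_eq with h | h
    · exact h
    · exfalso; rw [h] at hgt₂le; linarith
  have ht₂0 : t₂ < 0 := ht₂lt.trans hta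
  have habove : ∀ u ∈ Ioo t₂ ta, θ < -u * a u := by
    intro u hu
    by_contra hle
    push Not at hle
    have huS : u ∈ S := ⟨⟨htb₂.trans hu.1.le, hu.2.le⟩, hle⟩
    have := le_csSup hSbdd huS
    linarith [hu.1]
  have hIoo : Ioo t₂ ta ∈ 𝓝[>] t₂ := Ioo_mem_nhdsGT ht₂lt
  -- `g t₂ = θ`
  have hgt₂ : -t₂ * a t₂ = θ := by
    refine le_antisymm hgt₂le ?_
    have hct : Tendsto (fun u : ℝ => -u * a u) (𝓝[>] t₂) (𝓝 (-t₂ * a t₂)) :=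
      ((hg' t₂ ht₂0).continuousAt.continuousWithinAt).tendsto
    exact ge_of_tendsto hct (by filter_upwards [hIoo] with u hu using (habove u hu).le)
  -- `g'(t₂) ≥ 0`
  have hder : 0 ≤ -a t₂ - t₂ * (bigLam ε₀ / s ^ 2 * a (t₂ / s) ^ 2 - s / bigLam ε₀ * a t₂ * a (s * t₂)) := by
    have hsub : (Ioi t₂ : Set ℝ) ⊆ ({t₂}ᶜ : Set ℝ) := fun u hu => mem_compl_singleton_iff.2 (ne_of_gt hu)
    have hsl : Tendsto (slope (fun u : ℝ => -u * a u) t₂) (𝓝[>] t₂)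
        (𝓝 (-a t₂ - t₂ * (bigLam ε₀ / s ^ 2 * a (t₂ / s) ^ 2 - s / bigLam ε₀ * a t₂ * a (s * t₂)))) :=
      (hasDerivAt_iff_tendsto_slope.1 (hg' t₂ ht₂0)).mono_left (nhdsWithin_mono t₂ hsub)
    refine ge_of_tendsto hsl ?_
    filter_upwards [hIoo] with u hu
    rw [slope_def_field]
    have h1 : 0 < -u * a u - -t₂ * a t₂ := by rw [hgt₂]; linarith [habove u hu]
    have h2 : 0 < u - t₂ := by linarith [hu.1]
    exact (div_pos h1 h2).le
  -- Step D: the amplitude law at `t₂` against the rung bounds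
  have hlaw := amp_law (a := a) (ε₀ := ε₀) hs0.ne' hΛ.ne' t₂
  have hup := rung_up hε hs hode hM ht₂0
  have hdown := rung_down hε hs hode hM ht₂0
  have hK0 : 0 ≤ m + bigLam ε₀ * m ^ 2 + m ^ 2 / bigLam ε₀ :=
    le_trans (abs_nonneg _) (abs_mul_deriv_amp_le hε hs hM ht₂0)
  set K : ℝ := m + bigLam ε₀ * m ^ 2 + m ^ 2 / bigLam ε₀ with hK
  set δ : ℝ := K * (s - 1) with hδ
  have hδ0 : 0 ≤ δ := mul_nonneg hK0 (by linarith)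
  rw [hgt₂] at hlaw hup hdown
  -- neighbours within `δ` of `θ`
  have hup' : (-(t₂ / s) * a (t₂ / s)) ^ 2 ≤ (θ + δ) ^ 2 := by
    have h1 : |-(t₂ / s) * a (t₂ / s)| ≤ θ + δ := by
      have := abs_sub_abs_le_abs_sub (-(t₂ / s) * a (t₂ / s)) θ
      rw [abs_of_pos hθ0] at this
      linarith
    rw [← sq_abs]
    exact pow_le_pow_left₀ (abs_nonneg _) h1 2
  have hdown' : θ - δ ≤ -(s * t₂) * a (s * t₂) := by
    have := neg_abs_le (-(s * t₂) * a (s * t₂) - θ)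
    linarith
  -- `0 ≤ |t₂| g'(t₂) = −θ + Λ g(t₂/s)² − Λ⁻¹ θ g(st₂)`
  have hkey : 0 ≤ -θ + bigLam ε₀ * (-(t₂ / s) * a (t₂ / s)) ^ 2
      - (bigLam ε₀)⁻¹ * θ * (-(s * t₂) * a (s * t₂)) := by
    rw [← hlaw]
    exact mul_nonneg (by linarith) hder
  have hstar : 0 ≤ -θ + bigLam ε₀ * (θ + δ) ^ 2 - (bigLam ε₀)⁻¹ * θ * (θ - δ) := by
    have h1 : bigLam ε₀ * (-(t₂ / s) * a (t₂ / s)) ^ 2 ≤ bigLam ε₀ * (θ + δ) ^ 2 :=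
      mul_le_mul_of_nonneg_left hup' hΛ.le
    have h2 : (bigLam ε₀)⁻¹ * θ * (θ - δ) ≤ (bigLam ε₀)⁻¹ * θ * (-(s * t₂) * a (s * t₂)) :=
      mul_le_mul_of_nonneg_left hdown' (by positivity)
    linarith
  -- `Λθ² − Λ⁻¹θ² = θ/2`
  have hquad : bigLam ε₀ * θ ^ 2 - (bigLam ε₀)⁻¹ * θ ^ 2 = θ / 2 := by
    have : bigLam ε₀ * θ ^ 2 - (bigLam ε₀)⁻¹ * θ ^ 2 = ((bigLam ε₀ - (bigLam ε₀)⁻¹) * θ) * θ := by ring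
    rw [this, hθc]; ring
  have hexpand : -θ + bigLam ε₀ * (θ + δ) ^ 2 - (bigLam ε₀)⁻¹ * θ * (θ - δ)
      = -θ + (bigLam ε₀ * θ ^ 2 - (bigLam ε₀)⁻¹ * θ ^ 2)
        + δ * θ * (2 * bigLam ε₀ + (bigLam ε₀)⁻¹) + bigLam ε₀ * δ ^ 2 := by ring
  rw [hexpand, hquad] at hstar
  -- hstar : 0 ≤ -θ + θ/2 + δ θ (2Λ + Λ⁻¹) + Λ δ²
  -- conclude `δ ≥ 1/(6Λ + 2Λ⁻¹)`
  have hden : 0 < 6 * bigLam ε₀ + 2 / bigLam ε₀ := by positivity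
  by_contra hlt
  push Not at hlt
  -- hlt : K * (s - 1) < 1 / (6Λ + 2/Λ)
  have hlt' : δ < 1 / (6 * bigLam ε₀ + 2 / bigLam ε₀) := hlt
  have hθ' : 1 / (6 * bigLam ε₀ + 2 / bigLam ε₀) ≤ θ := by
    rw [hθ]
    apply one_div_le_one_div_of_le (by positivity)
    rw [div_eq_mul_inv]
    linarith
  have hδθ : δ ≤ θ := hlt'.le.trans hθ'
  have h1 : bigLam ε₀ * δ ^ 2 ≤ bigLam ε₀ * (δ * θ) := by
    apply mul_le_mul_of_nonneg_left _ hΛ.le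
    rw [sq]; exact mul_le_mul_of_nonneg_left hδθ hδ0
  have h2 : θ / 2 ≤ δ * θ * (3 * bigLam ε₀ + (bigLam ε₀)⁻¹) := by linarith [hstar, h1]
  have h3 : 1 / 2 ≤ δ * (3 * bigLam ε₀ + (bigLam ε₀)⁻¹) := by
    by_contra h4
    push Not at h4
    have : δ * θ * (3 * bigLam ε₀ + (bigLam ε₀)⁻¹) < θ / 2 := by
      have := mul_lt_mul_of_pos_left h4 hθ0
      linarith [this]
    linarith
  have h4 : δ * (6 * bigLam ε₀ + 2 / bigLam ε₀) < 1 := by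
    rw [lt_div_iff₀ hden] at hlt'; linarith
  rw [div_eq_mul_inv] at h4
  linarith

/-- **No slow fronts, with the type-I constant of the front itself.**  Every non-trivial profile of
`DyadicScalarFronts` admits a type-I bound `m > 0` (`WakeRatchetScalarFrontAdmissible.scale_bound`), and then
`s − 1 ≥ 1/((6Λ + 2Λ⁻¹)(m + Λm² + m²/Λ))`. [cite: Tao2016AveragedNS, §1.2, §4; elementary] -/
theorem hop_gap_pos (hε : 0 < ε₀) (hs : 1 < s)
    (hode : ∀ t : ℝ, t < 0 → HasDerivAt a
      (bigLam ε₀ / s ^ 2 * a (t / s) ^ 2 - s / bigLam ε₀ * a t * a (s * t)) t)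
    (hint : IntegrableOn a (Iio 0))
    (hbdd : ∃ t₀ : ℝ, t₀ < 0 ∧ ∃ P : ℝ, ∀ t : ℝ, t₀ ≤ t → t < 0 → |a t| ≤ P)
    (hne : ∃ t : ℝ, t < 0 ∧ a t ≠ 0) :
    ∃ m : ℝ, (∀ t : ℝ, t < 0 → |t| * |a t| ≤ m) ∧ 0 < m ∧
      1 / ((6 * bigLam ε₀ + 2 / bigLam ε₀) * (m + bigLam ε₀ * m ^ 2 + m ^ 2 / bigLam ε₀)) ≤ s - 1 := by
  obtain ⟨m, hm⟩ := WakeRatchetScalarFrontAdmissible.scale_bound hε hs hode hint hbdd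
  have hΛ1 : 1 < bigLam ε₀ := one_lt_bigLam' hε
  have hΛ : 0 < bigLam ε₀ := by linarith
  have h1 := scalarFront_one_le hε hs hode hint hbdd hne hm
  have hc : 0 < bigLam ε₀ - (bigLam ε₀)⁻¹ := by
    have : (bigLam ε₀)⁻¹ < 1 := inv_lt_one_of_one_lt₀ hΛ1
    linarith
  have hm0 : 0 < m := by
    by_contra h
    push Not at h
    have : (bigLam ε₀ - (bigLam ε₀)⁻¹) * m ≤ 0 := mul_nonpos_of_nonneg_of_nonpos hc.le h
    linarith
  have hK : 0 < m + bigLam ε₀ * m ^ 2 + m ^ 2 / bigLam ε₀ := by positivity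
  have hden : 0 < 6 * bigLam ε₀ + 2 / bigLam ε₀ := by positivity
  refine ⟨m, hm, hm0, ?_⟩
  have h := no_slow_front hε hs hode hint hbdd hne hm
  rw [div_le_iff₀ (mul_pos hden hK)]
  rw [div_le_iff₀ hden] at h
  linarith [h]

end WakeRatchetScalarFrontNoSlow

end Summit.NavierStokesRegularity.NavierStokesRegularity.Theorems

end
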